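import Summits.AnomalousDissipation.AnomalousDissipation.Theses.CoherentFraction
import Literature.Analysis.FluidPDE.LongTimeAverageNonneg

/-!
# Glue of the PlanarLiouvilleGate split of `CoherentFraction.BoundedQuietPlanarity` (stmt-AnomalousDissipation-33307)

Sorry-free proof of the GLUE item `CoherentFraction.PlanarLiouvilleGlue` (stmt-AnomalousDissipation-27430):
`TameEulerClimatesPlanar → TameClimateReduction → RoughQuietPlanarity → BoundedQuietPlanarity`, and of the exactness
of the cut `BoundedQuietPlanarity ↔ TameQuietPlanarity ∧ RoughQuietPlanarity` (aside stmt-AnomalousDissipation-27440).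
Mechanism: split a trajectory by whether its spectral enstrophy `eGradNormSq (u t)` is eventually `≤ ENNReal.ofReal R`
(tame: handled by `TameClimateReduction` applied to `TameEulerClimatesPlanar`) or frequently `> R` (rough: `RoughQuietPlanarity`),
with `θ₀ := min θ₁ θ₂` and `meanEnergy_nonneg` to pass from `θ₀ · E` to `θᵢ · E`.  No facts are asserted here.
Source: decomp-ad cell, lens-4 g16 node file `run/shared/lean/pub/decomp-ad/decomp-ad-lens-4/g16/PlanarLiouvilleGate.lean`
(pkg/CoherentFractionPlanarLiouvilleGlue.lean 90a619ef27df, re-checked against CoherentFraction rev5); landed by the cell's prover seat.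
-/

set_option linter.dupNamespace false

noncomputable section

open scoped BigOperators Topology ENNReal
open Filter MeasureTheory

namespace Summit.AnomalousDissipation.AnomalousDissipation.Theorems.PlanarLiouvilleGlue

open Summit.AnomalousDissipation.AnomalousDissipation.Theses

/-- Recombination of the tame/rough cut: tame half → rough half → parent (θ₀ := min). [folklore] -/
theorem boundedQuietPlanarity_of_tame_rough (hT : CoherentFraction.TameQuietPlanarity)
    (hR : CoherentFraction.RoughQuietPlanarity) : CoherentFraction.BoundedQuietPlanarity := by
  intro φ hφ M hM
  obtain ⟨R, hR⟩ := hR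
  obtain ⟨θ₁, hθ₁, h₁⟩ := hT R φ hφ M hM
  obtain ⟨θ₂, hθ₂, h₂⟩ := hR φ hφ M hM
  refine ⟨min θ₁ θ₂, lt_min hθ₁ hθ₂, fun ν hν hν1 u₀ u hu hE hq => ?_⟩
  have hE0 : 0 ≤ Literature.Analysis.FluidPDE.meanEnergy u := Literature.Analysis.FluidPDE.meanEnergy_nonneg u
  by_cases ht : ∀ᶠ t in Filter.atTop,
      Literature.Analysis.FunctionSpaces.Torus.eGradNormSq (u t) ≤ ENNReal.ofReal R
  · exact h₁ ν hν hν1 u₀ u hu ht hE (hq.trans (mul_le_mul_of_nonneg_right (min_le_left _ _) hE0))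
  · exact h₂ ν hν hν1 u₀ u hu ((Filter.not_eventually.mp ht).mono fun t h => not_le.mp h) hE
      (hq.trans (mul_le_mul_of_nonneg_right (min_le_right _ _) hE0))

/-- The parent is at least as strong as each half (restriction of the trajectory class). [folklore] -/
theorem tame_and_rough_of_boundedQuietPlanarity (h : CoherentFraction.BoundedQuietPlanarity) :
    CoherentFraction.TameQuietPlanarity ∧ CoherentFraction.RoughQuietPlanarity := by
  refine ⟨fun R φ hφ M hM => ?_, ⟨0, fun φ hφ M hM => ?_⟩⟩ <;>
  · obtain ⟨θ₀, hθ₀, h'⟩ := h φ hφ M hM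
    exact ⟨θ₀, hθ₀, fun ν hν hν1 u₀ u hu _ hE hq => h' ν hν hν1 u₀ u hu hE hq⟩

/-- EXACTNESS of the PlanarLiouvilleGate cut: parent ⟺ tame half ∧ rough half. [folklore] -/
theorem boundedQuietPlanarity_iff_tame_and_rough : CoherentFraction.BoundedQuietPlanarity ↔
    (CoherentFraction.TameQuietPlanarity ∧ CoherentFraction.RoughQuietPlanarity) :=
  ⟨tame_and_rough_of_boundedQuietPlanarity, fun h => boundedQuietPlanarity_of_tame_rough h.1 h.2⟩

/-- The GLUE item `CoherentFraction.PlanarLiouvilleGlue` (stmt-AnomalousDissipation-27430) holds. [folklore] -/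
theorem planarLiouvilleGlue_holds : CoherentFraction.PlanarLiouvilleGlue :=
  fun hN hRed hR => boundedQuietPlanarity_iff_tame_and_rough.mpr ⟨hRed hN, hR⟩

end Summit.AnomalousDissipation.AnomalousDissipation.Theorems.PlanarLiouvilleGlue

end
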